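import Summits.CriticalPhenomena.PercolationContinuityZ3.Theorems.Transplant.SkelPhiFaceNumsY2T
import Summits.CriticalPhenomena.PercolationContinuityZ3.Theorems.Transplant.SkelPhiFaceNumsY2
import Summits.CriticalPhenomena.PercolationContinuityZ3.Theorems.Transplant.SkelPhiFaceCellReadT
import Summits.CriticalPhenomena.PercolationContinuityZ3.Theorems.Transplant.SkelPhiFaceCellRead
import Summits.CriticalPhenomena.PercolationContinuityZ3.Theorems.Transplant.SkelPhiFaceRunNT
import Summits.CriticalPhenomena.PercolationContinuityZ3.Theorems.Transplant.SkelPhiFaceRunN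
import Summits.CriticalPhenomena.PercolationContinuityZ3.Theorems.Transplant.SkelPhiFaceNumsYP2
import Literature.Probability.Percolation.OrientedHistorySiteRenormalizationRun
import Summits.CriticalPhenomena.PercolationContinuityZ3.Theorems.Transplant.SkelPhiFaceDataNT
import Summits.CriticalPhenomena.PercolationContinuityZ3.Theorems.Transplant.SkelPhiFaceTargetMMT
import Summits.CriticalPhenomena.PercolationContinuityZ3.Theorems.Transplant.PlanarCells2TDefs
import HarnessLib
/-!
(R-40) SUCCESSOR `…T` (hp-8 g42, 2026-08-23; ruling p3-g16 06:23:56Z, J18): the twin of `SkelPhiFaceNumsYP2S` over the PER-AXIS creep cap `PCells2T` (PlanarCells2TDefs: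
`c i ≤ r (oth i)` instead of the uniform `c i ≤ cmax ≤ r j`); statements and proofs VERBATIM with `PCells2S ↦ PCells2T` (+ the renames of record of the T layer below it);
the only mathematical touch points are the places that read the cap, which only ever need the cross form `c (oth j) ≤ r j` (listed in the lane line of this file's landing).
NO landed file is edited; `SkelPhiFaceNumsYP2S` stays valid (and is an instance of this file through `PCells2S.toT`). NON-VACUITY: inherited verbatim from `SkelPhiFaceNumsYP2S` (same witness line).

# N2 (frames-only node `SamePDropOfSkeletonFrm₁`, OPEN) — WAVE 1, (F) face-data column over STAGGERED cells ((R-22) `PCells2T`, (R-28)(β) one landing per file): the twin of N1's `SkelPhiFaceNumsYP2`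

builds on p205010 (kernel theorem, internal audit signed; external expert review pending) — nothing in this file uses p205010; NOTHING is claimed about the
open node `SamePDropOfSkeletonFrm₁` (`SamePDropOfSkeletonNeg₁` is CLOSED in the tree and untouched by this file).
Status sentence (coordinator 2026-08-20T04:30Z): "θ(p_c) = 0 on ℤ^d, all d ≥ 2 — kernel-verified (Lean 4/Mathlib, standard axioms); internal adversarial
audit SIGNED 2026-08-20 04:29Z; external expert review pending."
Lane `prim-bschramm`, seat `prim-hp-8` (gen 40); helper file (`--supports stmt-CriticalPhenomena-4575 --as helper`); design owner p3-g15 ((R-22) staggered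
cells `PCells2T`, (R-27)/(R-29) far regions of record `FarNS/FarNS₂`, (R-28)(β), naming 2026-08-22T23:00:04Z: suffix `S`).
PORT RULES (HOME/prim-hp-8/code/gen40/orient/bin/port_s.py = stmt-g19's port_orient.py + the G token table): the cells are `P : PCells2T`, every box is
read about the STAGGERED centre `cenS` (`PlanarCells2SDefs/SFar/ContainS/SArm/SepS/SepInfS/LevelsS/EfarN2S`), the scheme record is `cellGeomSG₂T`/`cellGeomSG₂bT`
(`SkelPhiCellsWeakGS/…SmallMS`: narrow arm `BtwNS`, two-block far region `FarNS₂`), the history-site API is the ORIENTED one at `qNE` where it occurs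
(`ochoice qNE`, `onwardO`, `Valid₂O`, `IsRun₂O`, …, (R-18)); EVERY declaration is re-declared with the suffix `S` (same namespace). Docstrings/citations are N1's.
N1 HEADER (kept for the reader):
* structure **`Skelφ.FloorsY2`**, **`Skelφ.numsY_provider₂`** (a `def`: the numbers are data).
[cite: KozmaNitzan2024, §4 Lemma 11 (pp. 22–23), Lemma 12 (pp. 23–25)] [cite: MartineauTassion2017, §4.1, §4.3 Lemma 4.2]
-/
noncomputable section

open scoped Classical

namespace Summit.CriticalPhenomena.PercolationContinuityZ3.Theorems.Transplant

namespace Skelφ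

open Literature.Probability.Percolation Literature.Probability.LatticeModels SimpleGraph KNCells
open Literature.Probability.Percolation.KozmaNitzan
open Literature.Probability.Percolation.KozmaNitzan.Cells (oth oth_ne sgOf sgOf_sign stepVec_apply_fst eq_oth_of_ne oth_oth)
open KNLevels ChainPlanar ChainPara
open Literature.Barriers.CriticalPhenomena (graphBall mem_graphBall_self graphBall_mono)
open BoxProdZ2 (ConcRadiiG)
open TwoAxis.Para (modulus coarse lam0 lam1)

variable {V : Type} [DecidableEq V] {G : SimpleGraph V} [G.LocallyFinite] {φ : V → Site 2}

/-- **The linear floors of a y′-face centre** with contact cell `z` (habitat `flo = 5r + 10sj + 3 − lev z`, `fhi = 25r − 2 − lev z`,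
`fw = 5r⊥ − 4 − k₀ − c∥ − |z⊥ − cenS⊥|` (`c∥ = P.c du.1`, the stagger creep)): exactly the integer hypotheses of `numsY_of_floors₂T` (hop side `σh`, two-sign cross link, seed clearances at `Mz`). [this work] -/
structure FloorsY2T (pr : FinePrm) (nL : ℕ) (κ₀ κ₁ mod Vb : ℤ) (ℓ' : ℕ) (P : PCells2T) (b₀ : Fin 2 → ℕ) (x : Site 2) (du : MDir) (j : ℕ)
    (k₀ : ℤ) (r Mz : ℕ) (z : Site 2) (kA : Fin 2 → ℤ) (σh : ℤ) (B : BridgePrm) (R's qB R'₃ qB₃ : ℕ) (yL : Site 2) (Nr N₃ : ℕ) (σT : ℤ) :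
    Prop where
  -- the habitat versus the zone bounds
  hfR : (5 * (P.r du.1 : ℤ) + 10 * P.s du.1 * j + 3 - P.lev du x z) ≤ -kA du.1 ∧ kA du.1 ≤ (25 * (P.r du.1 : ℤ) - 2 - P.lev du x z) ∧
    kA (oth du.1) ≤ (5 * (P.r (oth du.1) : ℤ) - 4 - k₀ - P.c du.1 - |z (oth du.1) - P.cenS x (oth du.1)|)
  hZfar : P.lev du x z + kA du.1 + 1 < 20 * (P.r du.1 : ℤ) - b₀ du.1
  hσT : σT = 1 ∨ σT = -1
  -- floors: along y′-run at yL (sign σ = sgOf du): along habitat on axis 1, transverse on axis 0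
  FA1 : sgOf du = 1 → ∀ k ≤ Nr, mod * ((5 * (P.r du.1 : ℤ) + 10 * P.s du.1 * j + 3 - P.lev du x z) - coarse pr.c₁ (pr.D / 2) pr.D (lam1 pr.A nL pr.h yL)) ≤
      κ₁ * ((shearUnit nL pr.h : ℤ) * (ySLo nL ℓ' pr.h qB R's 1 k - 1)) - mod + 1
  FA2 : sgOf du = 1 → ∀ k ≤ Nr, mod * (coarse pr.c₁ (pr.D / 2) pr.D (lam1 pr.A nL pr.h yL) + 1) +
      κ₁ * ((shearUnit nL pr.h : ℤ) * ySHi nL ℓ' pr.h qB R's 1 k + shearUnit nL pr.h - 1) ≤ mod * (25 * (P.r du.1 : ℤ) - 2 - P.lev du x z)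
  FA3 : sgOf du = -1 → ∀ k ≤ Nr, mod * ((5 * (P.r du.1 : ℤ) + 10 * P.s du.1 * j + 3 - P.lev du x z) + coarse pr.c₁ (pr.D / 2) pr.D (lam1 pr.A nL pr.h yL) + 1) ≤
      -(κ₁ * ((shearUnit nL pr.h : ℤ) * ySHi nL ℓ' pr.h qB R's (-1) k + shearUnit nL pr.h - 1))
  FA4 : sgOf du = -1 → ∀ k ≤ Nr, -(mod * coarse pr.c₁ (pr.D / 2) pr.D (lam1 pr.A nL pr.h yL)) -
      κ₁ * ((shearUnit nL pr.h : ℤ) * (ySLo nL ℓ' pr.h qB R's (-1) k - 1)) + mod - 1 ≤ mod * (25 * (P.r du.1 : ℤ) - 2 - P.lev du x z)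
  FA5 : ∀ k ≤ Nr, (nL : ℤ) * mod * (-(5 * (P.r (oth du.1) : ℤ) - 4 - k₀ - P.c du.1 - |z (oth du.1) - P.cenS x (oth du.1)|) - coarse pr.c₀ (pr.D / 2) pr.D (lam0 pr.A pr.vα pr.vβ yL)) ≤ -(κ₀ * (yBnd nL ℓ' pr.h mod qB R's k + 2 * nL)) - nL * mod
  FA6 : ∀ k ≤ Nr, (nL : ℤ) * mod * (coarse pr.c₀ (pr.D / 2) pr.D (lam0 pr.A pr.vα pr.vβ yL) + 1) + κ₀ * (yBnd nL ℓ' pr.h mod qB R's k + nL) ≤ nL * mod * (5 * (P.r (oth du.1) : ℤ) - 4 - k₀ - P.c du.1 - |z (oth du.1) - P.cenS x (oth du.1)|)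
  -- floors: tangential x-run at yT (sign σT)
  FT1 : sgOf du = 1 → ∀ k ≤ N₃, mod * ((5 * (P.r du.1 : ℤ) + 10 * P.s du.1 * j + 3 - P.lev du x z) - coarse pr.c₁ (pr.D / 2) pr.D (lam1 pr.A nL pr.h (yL + crossOffY nL ℓ' pr.h pr.vα (sgOf du) Nr))) ≤
      -(κ₁ * (shearUnit nL pr.h : ℤ) * (xBoxB nL ℓ' pr.h R'₃ k + 1)) - mod + 1
  FT2 : sgOf du = 1 → ∀ k ≤ N₃, mod * (coarse pr.c₁ (pr.D / 2) pr.D (lam1 pr.A nL pr.h (yL + crossOffY nL ℓ' pr.h pr.vα (sgOf du) Nr)) + 1) +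
      κ₁ * ((shearUnit nL pr.h : ℤ) * xBoxB nL ℓ' pr.h R'₃ k + shearUnit nL pr.h - 1) ≤ mod * (25 * (P.r du.1 : ℤ) - 2 - P.lev du x z)
  FT3 : sgOf du = -1 → ∀ k ≤ N₃, mod * ((5 * (P.r du.1 : ℤ) + 10 * P.s du.1 * j + 3 - P.lev du x z) + coarse pr.c₁ (pr.D / 2) pr.D (lam1 pr.A nL pr.h (yL + crossOffY nL ℓ' pr.h pr.vα (sgOf du) Nr)) + 1) ≤
      -(κ₁ * ((shearUnit nL pr.h : ℤ) * xBoxB nL ℓ' pr.h R'₃ k + shearUnit nL pr.h - 1))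
  FT4 : sgOf du = -1 → ∀ k ≤ N₃, -(mod * coarse pr.c₁ (pr.D / 2) pr.D (lam1 pr.A nL pr.h (yL + crossOffY nL ℓ' pr.h pr.vα (sgOf du) Nr))) +
      κ₁ * (shearUnit nL pr.h : ℤ) * (xBoxB nL ℓ' pr.h R'₃ k + 1) + mod - 1 ≤ mod * (25 * (P.r du.1 : ℤ) - 2 - P.lev du x z)
  FT5 : ∀ k ≤ N₃, (nL : ℤ) * mod * (-(5 * (P.r (oth du.1) : ℤ) - 4 - k₀ - P.c du.1 - |z (oth du.1) - P.cenS x (oth du.1)|) - coarse pr.c₀ (pr.D / 2) pr.D (lam0 pr.A pr.vα pr.vβ (yL + crossOffY nL ℓ' pr.h pr.vα (sgOf du) Nr))) ≤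
      κ₀ * mod * xSLo nL qB₃ R'₃ σT k - κ₀ * Vb * (shearUnit nL pr.h : ℤ) * (xBoxB nL ℓ' pr.h R'₃ k + 1) - κ₀ * nL - nL * mod
  FT6 : ∀ k ≤ N₃, (nL : ℤ) * mod * (coarse pr.c₀ (pr.D / 2) pr.D (lam0 pr.A pr.vα pr.vβ (yL + crossOffY nL ℓ' pr.h pr.vα (sgOf du) Nr)) + 1) +
      κ₀ * mod * xSHi nL qB₃ R'₃ σT k + κ₀ * Vb * (shearUnit nL pr.h : ℤ) * (xBoxB nL ℓ' pr.h R'₃ k + 1) ≤ nL * mod * (5 * (P.r (oth du.1) : ℤ) - 4 - k₀ - P.c du.1 - |z (oth du.1) - P.cenS x (oth du.1)|)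
  -- floors: the target box on the x-run's last core
  FL1 : (nL : ℤ) * mod * (P.cenS (x + stepVec du) 0 - b₀ 0 + 2 - z 0 -
      coarse pr.c₀ (pr.D / 2) pr.D (lam0 pr.A pr.vα pr.vβ (yL + crossOffY nL ℓ' pr.h pr.vα (sgOf du) Nr))) ≤
      κ₀ * mod * xCSLo nL qB₃ R'₃ σT (N₃ + 1) - κ₀ * Vb * (shearUnit nL pr.h : ℤ) * (xCoreB nL ℓ' pr.h R'₃ (N₃ + 1) + 1) - κ₀ * nL - nL * mod
  FL2 : (nL : ℤ) * mod * (coarse pr.c₀ (pr.D / 2) pr.D (lam0 pr.A pr.vα pr.vβ (yL + crossOffY nL ℓ' pr.h pr.vα (sgOf du) Nr)) + 1) +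
      κ₀ * mod * xCSHi nL qB₃ R'₃ σT (N₃ + 1) + κ₀ * Vb * (shearUnit nL pr.h : ℤ) * (xCoreB nL ℓ' pr.h R'₃ (N₃ + 1) + 1) ≤
      nL * mod * (P.cenS (x + stepVec du) 0 + b₀ 0 - 2 - z 0)
  FL3 : mod * (P.cenS (x + stepVec du) 1 - b₀ 1 + 2 - z 1 - coarse pr.c₁ (pr.D / 2) pr.D (lam1 pr.A nL pr.h (yL + crossOffY nL ℓ' pr.h pr.vα (sgOf du) Nr))) ≤
      -(κ₁ * (shearUnit nL pr.h : ℤ) * (xCoreB nL ℓ' pr.h R'₃ (N₃ + 1) + 1)) - mod + 1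
  FL4 : mod * (coarse pr.c₁ (pr.D / 2) pr.D (lam1 pr.A nL pr.h (yL + crossOffY nL ℓ' pr.h pr.vα (sgOf du) Nr)) + 1) +
      κ₁ * ((shearUnit nL pr.h : ℤ) * xCoreB nL ℓ' pr.h R'₃ (N₃ + 1) + shearUnit nL pr.h - 1) ≤ mod * (P.cenS (x + stepVec du) 1 + b₀ 1 - 2 - z 1)
  -- the cross link floors
  hq₃ : 2 * (nL : ℤ) + ((Nr : ℤ) + 1) * R's ≤ qB₃
  hW : ((Nr : ℤ) + 1) * (((nL : ℤ) * ℓ' / (shearUnit nL pr.h : ℕ) + 1) - ((nL : ℤ) * ℓ' - (shearUnit nL pr.h : ℕ) + 1) / (shearUnit nL pr.h : ℕ)) + qB +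
      ((Nr : ℤ) + 1) * R's + 2 ≤ ((nL * ℓ' / shearUnit nL pr.h + 1 : ℕ) : ℤ)
  -- the bridge box, clearances, reaches
  /-- the hop side is a sign -/
  hσh : σh = 1 ∨ σh = -1
  hxaY : ∀ y ∈ Finset.Icc B.core1Lo B.core1Hi,
      -((((nL : ℤ) + pr.vα).toNat : ℕ) : ℤ) ≤ sgOf du * σh * y 0 - sgOf du * yL 0 ∧ sgOf du * σh * y 0 - sgOf du * yL 0 ≤ ((((nL : ℤ) - pr.vα).toNat : ℕ) : ℤ)
  hxbY : ∀ y ∈ Finset.Icc B.core1Lo B.core1Hi,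
      |sgOf du * ((nL : ℤ) * (y 1 - yL 1) - pr.h * (σh * y 0 - yL 0))| + shearUnit nL pr.h ≤ ((qB : ℤ) + 1) * shearUnit nL pr.h
  /-- seed clearance of the along y′-run when the hop side is the run side (`sgOf du·σh = 1`): the regions' transverse range stays above `Mz` -/
  hclrLo : sgOf du * σh = 1 → ∀ k ≤ Nr, (Mz : ℤ) < yBoxLoT nL pr.vα R's k + sgOf du * yL 0
  /-- seed clearance of the along y′-run when the hop side is opposite (`sgOf du·σh = −1`): the regions' transverse range stays below `−Mz` -/
  hclrHi : sgOf du * σh = -1 → ∀ k ≤ Nr, yBoxHiT nL pr.vα R's k + sgOf du * yL 0 < -(Mz : ℤ)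
  /-- seed clearance of the tangential x-run, per region: the α-floor over the along range OR the level floor -/
  hclr₃ : ∀ k ≤ N₃, (∀ b : ℤ, min (σT * xBoxLoA nL qB₃ R'₃ k) (σT * xBoxHiA nL qB₃ R'₃ k) ≤ b →
      b ≤ max (σT * xBoxLoA nL qB₃ R'₃ k) (σT * xBoxHiA nL qB₃ R'₃ k) → (Mz : ℤ) < |b + (yL + crossOffY nL ℓ' pr.h pr.vα (sgOf du) Nr) 0|) ∨
      ((shearUnit nL pr.h : ℤ) * Mz + (shearUnit nL pr.h : ℤ) * (xBoxB nL ℓ' pr.h R'₃ k + 1) ≤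
        |(nL : ℤ) * (yL + crossOffY nL ℓ' pr.h pr.vα (sgOf du) Nr) 1 - pr.h * (yL + crossOffY nL ℓ' pr.h pr.vα (sgOf du) Nr) 0|)
  hπ2Y : ∀ k ≤ Nr, ((yL 0).natAbs + (yL 1).natAbs) + (((((k + 1 : ℕ) : ℤ) * pr.vα).natAbs +
      (((shearUnit nL pr.h : ℤ) * |((k + 1 : ℕ) : ℤ) * (yPrmW nL ℓ' pr.h pr.vα R's qB Nr).sLo| + |pr.h| * |((k + 1 : ℕ) : ℤ) * pr.vα| + shearUnit nL pr.h) / nL).natAbs + 1))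
      ≤ r
  hπ3Y : (((yL + crossOffY nL ℓ' pr.h pr.vα (sgOf du) Nr) 0).natAbs + ((yL + crossOffY nL ℓ' pr.h pr.vα (sgOf du) Nr) 1).natAbs) + (N₃ + 1) * shearUnit nL pr.h ≤ r

/-- **THE y′-FACE NUMBERS PROVIDER, v2**: the `numsY` binder of the keystone v6 from centre-free data (see `numsX_provider₂T`); the hop side per
direction is the caller's choice function `σhF` (the bridge family is read at `B (σhF du)`).
[cite: KozmaNitzan2024, §4 Lemma 12 (pp. 23–25)] -/
def numsY_provider₂T (hstep : Steps G φ) (pr : FinePrm) (w₀ : V) {nL : ℕ} (hn : pr.n = nL) (hnL : 1 ≤ nL) (hvL : |pr.vα| ≤ nL)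
    (hc₀ : 0 < pr.c₀) (hc₁ : 0 < pr.c₁) (hD : 0 < pr.D) (hlipψ : Lip G (pr.ψ φ w₀)) (hws : WeakSteps G (pr.ψ φ w₀))
    {κ₀ κ₁ mod Vb : ℤ} (hA : 0 < pr.A) (hκ₀ : 0 ≤ κ₀) (hVb : |pr.vα| ≤ Vb) (hc0 : pr.c₀ = pr.A * κ₀) (hc1 : pr.c₁ = pr.A * κ₁)
    (hmod : modulus nL pr.h pr.vα pr.vβ = mod) (hmod0 : 0 < mod) (hDm : pr.D = pr.A ^ 2 * mod)
    {ℓ' : ℕ} (hlay : (nL + pr.h.natAbs : ℕ) ≤ (nL : ℤ) * ℓ' + 1) (hmodlo : (nL : ℤ) * ℓ' - (shearUnit nL pr.h : ℤ) + 1 ≤ mod)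
    (hmodhi : mod ≤ (nL : ℤ) * ℓ')
    (P : PCells2T) (Λ : ConcRadiiG) (b₀ : Fin 2 → ℕ) {L' : ℕ} (hL' : 1 ≤ L') (hrM : ∀ (a' : ℕ) (x : Site 2) (du : MDir), L' ≤ Λ.rM a' (x + stepVec du))
    {k₀ : ℤ} (hk₀ : 0 ≤ k₀) {r : ℕ} (hrE : ∀ (a' : ℕ) (x : Site 2) (du : MDir), r ≤ Λ.rE a' x du)
    (aw : MDir → ℕ) (E : ℕ) {kE : ℤ} (hnz : ∀ du : MDir, pr.lvGen du.1 (pr.bOf du.1) ≠ 0)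
    (hroom : ∀ du : MDir, pr.Mabs * (aw du + E) + pr.rdN du.1 (pr.bOf du.1) * (E + 1) * pr.D ≤ pr.rdK du.1 (pr.bOf du.1) * kE * pr.D)
    (Λc : V → ℕ → Finset V) (Mz : ℕ) (kA : Fin 2 → ℤ) (hZk : ∀ (c' : V) (du : MDir), ∀ v ∈ Λc c' Mz, |pr.ψ φ c' v du.1| ≤ kA du.1)
    (σhF : MDir → ℤ) (B : ℤ → BridgePrm) (R's qB R'₃ qB₃ : ℕ) (yLF : Site 2 → MDir → ℕ → Site 2 → Site 2) (NrF N3F : Site 2 → MDir → ℕ → Site 2 → ℕ)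
    (σTF : Site 2 → MDir → ℕ → Site 2 → ℤ)
    (floors : ∀ (x : Site 2) (du : MDir) (j : ℕ) (z : Site 2), du.1 = 1 → j < P.K → (P.faceL du.1 j : ℤ) - E ≤ P.lev du x z →
      P.lev du x z ≤ P.faceL du.1 j + E → |z (oth du.1) - P.cenS x (oth du.1)| ≤ kE →
      FloorsY2T pr nL κ₀ κ₁ mod Vb ℓ' P b₀ x du j k₀ r Mz z kA (σhF du) (B (σhF du)) R's qB R'₃ qB₃ (yLF x du j z) (NrF x du j z) (N3F x du j z)
        (σTF x du j z)) :
    ∀ (a' : ℕ) (x : Site 2) (du : MDir) (j : ℕ) (pc : ℤ) (c' : V), du.1 = 1 → j < P.K → ∀ yF : V,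
      pr.ψ φ w₀ yF = P.faceCen x du j → pc = relφ φ w₀ yF (pr.bOf du.1) →
      pr.frame φ w₀ du.1 (pr.bOf du.1) c' ∈ Finset.Icc (loNT P x du j pc (aw du) - ((E : ℕ) : Site 2)) (hiNT P x du j pc (aw du) + ((E : ℕ) : Site 2)) →
      c' ∈ graphBall G w₀ (Λ.rE a' x du - r) →
      FaceRunNumsY4 G φ (pr.ψ φ w₀) c' pr.A nL pr.h pr.vα pr.vβ pr.c₀ pr.c₁ pr.D du (σhF du) (sgOf du) (B (σhF du)) ℓ' R's qB R'₃ qB₃ pr.vα hnL hvL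
        hlay Mz (P.farCore x du j k₀) (targetMMT G φ pr P w₀ Λ b₀ a' x du L') (Λc c' Mz) r (kA du.1) (kA (oth du.1)) := by
  intro a' x du j pc c' hI hj yF hyF hpc hbox hball
  obtain ⟨hL1, hL2, hwc⟩ := cell_of_frame_boxT (φ := φ) pr w₀ hc₀ hc₁ hD P (hnz du) hyF hpc (hroom du) hbox
  have F := floors x du j (pr.ψ φ w₀ c') hI hj hL1 hL2 hwc
  refine Classical.choice (numsY_of_floors₂T hstep pr w₀ hn hnL hvL hD hlipψ hws hA hκ₀ hVb hc0 hc1 hmod hmod0 hDm hlay hmodlo hmodhi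
    P Λ b₀ a' x du hI j hL' (hrM a' x du) hk₀ c' hball (hrE a' x du) Mz le_rfl (le_of_eq (by ring)) (le_of_eq (by ring)) (le_of_eq (by ring))
    F.hfR (Λc c' Mz) (hZk c' du) F.hZfar F.hσh (B (σhF du)) R's qB R'₃ qB₃ (yLF x du j (pr.ψ φ w₀ c')) (NrF x du j (pr.ψ φ w₀ c'))
    (N3F x du j (pr.ψ φ w₀ c')) F.hσT F.FA1 F.FA2 F.FA3 F.FA4 F.FA5 F.FA6 F.FT1 F.FT2 F.FT3 F.FT4 F.FT5 F.FT6 F.FL1 F.FL2 F.FL3 F.FL4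
    F.hq₃ F.hW F.hxaY F.hxbY F.hclrLo F.hclrHi F.hclr₃ F.hπ2Y F.hπ3Y)

end Skelφ

end Summit.CriticalPhenomena.PercolationContinuityZ3.Theorems.Transplant

end
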